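import Mathlib
import Summits.CriticalPhenomena.CardyFormulaZ2.Theorems.CardyMagicRigidityNestingRigidityUVFarBiteMultiScale
import Summits.CriticalPhenomena.CardyFormulaZ2.Theorems.CardyMagicRigidityNestingRigidityBigLoopsExpMomentMeetBall
import HarnessLib

/-!
# Line `Sketch` of crux `MagicFormulaT`, stub S1 `stub_bandExpMoment`: band exponential moments

Crux `Summit.CriticalPhenomena.CardyFormulaZ2.Theses.CardyMagicRigidity.MagicFormulaT`
(stmt-CriticalPhenomena-4836), line `Sketch` (skeleton v6), stub `stub_bandExpMoment` (S1: the
multi-scale machine with the scale cut-off explicit), proved EXACTLY as registered.  For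
`E ∈ latticeEnsembles` and an order bound `A` there is `K₀ > 0` with: for every region
`D ⊆ B(x₀, ρ)`, loop functional `g` with `|g u| ≤ κ diam(u)²` on the loops inside `D` and `g u = 0`
once `diam(u) ≥ η` (`0 < δ ≤ η ≤ ρ`), and `|a| κ ρ² ≤ A`, the centred statistic
`S = Σ_{u ∈ X_δ, trace u ⊆ D} g u` has `E_δ exp(a (S − E_δ S)) ≤ exp(K₀ a² κ² ρ³ η)`.

Proof: the template `expMoment_centred_finsum_inner_le_latticeEnsembles` (…UVFarBiteMultiScale)
with better bookkeeping.  As `g` vanishes on the loops of diameter `≥ η`, `S` is the statistic of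
the loops of diameter `< η` (`bem_finsum_restrict`), so the dyadic scales start at the TOP SIDE
`H = η`: `h_k = η 2^{-k}`, `k < n`, down to the microscopic side `4δ`.  K6 input: the keystone
`expMoment_ncard_bigLoops_le_ball_free` (all centres and scales, NO mesh constraint) at order
`72 A + 1`; microscopic count: `exists_ncard_loops_subset_ball_le` (radius `12δ`); pieces
`UVFarBite.scalePiece` / `UVFarBite.microPiece`, assembled by `expMoment_scaleSum_le_latticeEnsembles`
(weights `2^{-k-3}`, `1/2`).  Exponents: `#cells ≤ (2ρ/h_k + 2)² ≤ 16ρ²/h_k²`, `1/w_k = 8η/h_k`, so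
`B_k ≤ 2304 a²κ²ρ²η K² h_k` and `Σ_k B_k ≤ 4608 K² a²κ²ρ³η`; the microscopic exponent is
`≤ 57600 a²κ²ρ²δ² Kμ² ≤ 57600 Kμ² a²κ²ρ³η` (`Kμ = e^{(288A+1)M}`); `K₀ = 4608 K² + 57600 Kμ² + 1`.
No cited fact, no definition. -/
noncomputable section

namespace Summit.CriticalPhenomena.CardyFormulaZ2.Cruxes.MagicFormulaT.LineSketch

open MeasureTheory Filter Set Metric
open scoped Real Topology BigOperators
open Literature.Probability.RandomPlanarGeometry Literature.Probability.Percolation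
  Literature.Probability.LatticeModels
open Summit.CriticalPhenomena.CardyFormulaZ2.Cruxes.NestingRigidity.RingCloudTomography
open Summit.CriticalPhenomena.CardyFormulaZ2.Cruxes.NestingRigidity.PositiveConeWeightDoubling

/-- Abscissa of the left edge of the bounding box of a loop (local notation, as in …UVFarBiteCells). -/
local notation3 "XI[" u "]" => sInf (Complex.re '' UnbasedLoop.range u)
/-- Ordinate of the bottom edge of the bounding box of a loop (local notation). -/
local notation3 "YI[" u "]" => sInf (Complex.im '' UnbasedLoop.range u)
/-- The grid cell (side `h`) containing the lower-left corner of the bounding box (local notation). -/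
local notation3 "IDX[" h ", " u "]" => ((⌊XI[u] / h⌋, ⌊YI[u] / h⌋) : ℤ × ℤ)
/-- The doubled cell `[ih, (i+2)h] × [jh, (j+2)h]` of the grid cell `c = (i, j)` (local notation). -/
local notation3 "BOX[" h ", " c "]" => {z : ℂ | ((Prod.fst c : ℤ) : ℝ) * h ≤ z.re ∧
  z.re ≤ (((Prod.fst c : ℤ) : ℝ) + 2) * h ∧ ((Prod.snd c : ℤ) : ℝ) * h ≤ z.im ∧
  z.im ≤ (((Prod.snd c : ℤ) : ℝ) + 2) * h}
/-- The centre `((i+1)h, (j+1)h)` of the doubled cell (local notation). -/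
local notation3 "CTR[" h ", " c "]" =>
  (Complex.mk ((((Prod.fst c : ℤ) : ℝ) + 1) * h) ((((Prod.snd c : ℤ) : ℝ) + 1) * h) : ℂ)
/-- The cells that loops inside `B(x₀, ρ)` can be assigned to (local notation). -/
local notation3 "RNG[" h ", " x₀ ", " ρ "]" => (Finset.Icc ⌊(Complex.re x₀ - ρ) / h⌋ ⌊(Complex.re x₀ + ρ) / h⌋ ×ˢ
  Finset.Icc ⌊(Complex.im x₀ - ρ) / h⌋ ⌊(Complex.im x₀ + ρ) / h⌋ : Finset (ℤ × ℤ))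

/-! ## Helpers: the cut-off family, and the exponent arithmetic with top side `η` -/

/-- **Only the loops of diameter `< η` count**: a weight vanishing on the loops inside `D` of
diameter `≥ η` has the same inner statistic on the cut-off loop family. -/
theorem bem_finsum_restrict (L : Set (UnbasedLoop ℂ)) (D : Set ℂ) {η : ℝ} (g : UnbasedLoop ℂ → ℝ)
    (hg0 : ∀ u : UnbasedLoop ℂ, u.range ⊆ D → η ≤ diam u.range → g u = 0) :
    ∑ᶠ u ∈ {u ∈ L | u.range ⊆ D}, g u =
      ∑ᶠ u ∈ {u ∈ {u ∈ L | diam u.range < η} | u.range ⊆ D}, g u := by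
  refine finsum_mem_inter_support_eq' _ _ _ fun u hu ↦
    ⟨fun h ↦ ⟨⟨h.1, ?_⟩, h.2⟩, fun h ↦ ⟨h.1.1, h.2⟩⟩
  by_contra hlt
  exact (Function.mem_support.1 hu) (hg0 u h.2 (not_lt.1 hlt))

/-- Dropping the (redundant) cut-off from a microscopic cell family. -/
theorem bem_sep_micro_eq (L : Set (UnbasedLoop ℂ)) (P : Set ℂ) {η b t : ℝ} (hb : b ≤ η)
    (c : ℤ × ℤ) :
    {u ∈ {u ∈ L | diam u.range < η} | u.range ⊆ P ∧ (diam u.range < b ∧ IDX[t, u] = c)} =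
      {u ∈ L | u.range ⊆ P ∧ (diam u.range < b ∧ IDX[t, u] = c)} := by
  ext u
  simp only [mem_setOf_eq]
  exact ⟨fun h ↦ ⟨h.1.1, h.2⟩, fun h ↦ ⟨⟨h.1, h.2.2.1.trans_le hb⟩, h.2⟩⟩

/-- Dropping the (redundant) cut-off from a dyadic-scale cell family. -/
theorem bem_sep_scale_eq (L : Set (UnbasedLoop ℂ)) (P : Set ℂ) {η b b' t : ℝ} (hb : b ≤ η)
    (c : ℤ × ℤ) :
    {u ∈ {u ∈ L | diam u.range < η} |
        u.range ⊆ P ∧ ((b' ≤ diam u.range ∧ diam u.range < b) ∧ IDX[t, u] = c)} =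
      {u ∈ L | u.range ⊆ P ∧ ((b' ≤ diam u.range ∧ diam u.range < b) ∧ IDX[t, u] = c)} := by
  ext u
  simp only [mem_setOf_eq]
  exact ⟨fun h ↦ ⟨h.1.1, h.2⟩, fun h ↦ ⟨⟨h.1, h.2.2.1.2.trans_le hb⟩, h.2⟩⟩

/-- **The order constraint at scale `k`** (top side `η`): `9 |a/w_k| κ h_k² = 72 |a| κ η² / 2^k`. -/
theorem bem_order_scale_le (a κ η : ℝ) (hκ : 0 ≤ κ) (k : ℕ) :
    9 * (|a / (1 / (8 * 2 ^ k))| * (κ * (η / 2 ^ k) ^ 2)) ≤ 72 * |a| * κ * η ^ 2 := by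
  set t : ℝ := 2 ^ k with ht
  have ht0 : 0 < t := by positivity
  have ht1 : 1 ≤ t := one_le_pow₀ (by norm_num)
  rw [abs_div, abs_of_pos (by positivity : (0 : ℝ) < 1 / (8 * t))]
  have e : 9 * (|a| / (1 / (8 * t)) * (κ * (η / t) ^ 2)) = 72 * |a| * κ * η ^ 2 / t := by
    field_simp; ring
  rw [e]
  exact div_le_self (by positivity) ht1

/-- **The exponent at scale `k`** (top side `η ≤ ρ`): with `#cells ≤ (2ρ/h_k + 2)² ≤ 16ρ² 4^k/η²`,
`w_k · 2 · #cells · 9 · (a/w_k)² (κ h_k²)² K² ≤ 2304 a² κ² ρ² η² K² (1/2)^k`. -/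
theorem bem_exponent_scale_le {a κ ρ η K S : ℝ} (hη : 0 < η) (hηρ : η ≤ ρ) (k : ℕ)
    (hS : S ≤ (2 * ρ / (η / 2 ^ k) + 2) ^ 2) :
    1 / (8 * 2 ^ k) * (2 * S * (9 : ℕ) * (a / (1 / (8 * 2 ^ k))) ^ 2 * (κ * (η / 2 ^ k) ^ 2) ^ 2 *
      K ^ 2) ≤ 2304 * a ^ 2 * κ ^ 2 * ρ ^ 2 * η ^ 2 * K ^ 2 * (1 / 2) ^ k := by
  set t : ℝ := 2 ^ k with ht
  have ht0 : 0 < t := by positivity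
  have ht1 : 1 ≤ t := one_le_pow₀ (by norm_num)
  have hS' : S ≤ 16 * ρ ^ 2 * t ^ 2 / η ^ 2 := by
    refine hS.trans ?_
    have e1 : 2 * ρ / (η / t) + 2 = 2 * ρ * t / η + 2 := by field_simp
    have h1 : 2 ≤ 2 * ρ * t / η := by rw [le_div_iff₀ hη]; nlinarith
    have h0 : 0 ≤ 2 * ρ * t / η := by positivity
    rw [e1]
    calc (2 * ρ * t / η + 2) ^ 2 ≤ (2 * ρ * t / η + 2 * ρ * t / η) ^ 2 := by gcongr
      _ = 16 * ρ ^ 2 * t ^ 2 / η ^ 2 := by field_simp; ring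
  have e : 1 / (8 * t) * (2 * S * (9 : ℕ) * (a / (1 / (8 * t))) ^ 2 * (κ * (η / t) ^ 2) ^ 2 * K ^ 2) =
      S * (144 * a ^ 2 * κ ^ 2 * η ^ 4 * K ^ 2 / t ^ 3) := by
    push_cast; field_simp; ring
  rw [e, one_div_pow, ← ht]
  calc S * (144 * a ^ 2 * κ ^ 2 * η ^ 4 * K ^ 2 / t ^ 3)
      ≤ 16 * ρ ^ 2 * t ^ 2 / η ^ 2 * (144 * a ^ 2 * κ ^ 2 * η ^ 4 * K ^ 2 / t ^ 3) :=
        mul_le_mul_of_nonneg_right hS' (by positivity)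
    _ = 2304 * a ^ 2 * κ ^ 2 * ρ ^ 2 * η ^ 2 * K ^ 2 * (1 / t) := by field_simp; ring

/-- **The microscopic exponent** (side `s = 4δ`, `δ ≤ η ≤ ρ`, `#cells ≤ (2ρ/s + 2)²`, `K' ≤ Kμ`):
`(1/2) · 2 · #cells · 9 · (2a)² (κ s²)² K'² ≤ 57600 a² κ² ρ² δ² Kμ² ≤ 57600 a² κ² ρ³ η Kμ²`. -/
theorem bem_exponent_micro_le {a κ ρ δ η s c₀ S K' Kμ : ℝ} (hδ : 0 < δ) (hδη : δ ≤ η) (hηρ : η ≤ ρ)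
    (hs : s = 4 * c₀ * δ) (hc₀ : c₀ = 1) (hS : S ≤ (2 * ρ / s + 2) ^ 2) (hK'0 : 0 ≤ K')
    (hK' : K' ≤ Kμ) :
    1 / 2 * (2 * S * (9 : ℕ) * (a / (1 / 2)) ^ 2 * (κ * s ^ 2) ^ 2 * K' ^ 2) ≤
      57600 * a ^ 2 * κ ^ 2 * ρ ^ 3 * η * Kμ ^ 2 := by
  rw [hc₀] at hs
  have hδρ : δ ≤ ρ := hδη.trans hηρ
  have hρ : 0 < ρ := hδ.trans_le hδρ
  have hs0 : 0 < s := by rw [hs]; positivity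
  have e1 : 1 / 2 * (2 * S * (9 : ℕ) * (a / (1 / 2)) ^ 2 * (κ * s ^ 2) ^ 2 * K' ^ 2) =
      36 * S * a ^ 2 * κ ^ 2 * s ^ 4 * K' ^ 2 := by push_cast; ring
  rw [e1]
  have h1 : 36 * S * a ^ 2 * κ ^ 2 * s ^ 4 * K' ^ 2 ≤
      36 * (2 * ρ / s + 2) ^ 2 * a ^ 2 * κ ^ 2 * s ^ 4 * Kμ ^ 2 := by gcongr
  refine h1.trans ?_
  have e2 : 36 * (2 * ρ / s + 2) ^ 2 * a ^ 2 * κ ^ 2 * s ^ 4 * Kμ ^ 2 =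
      36 * a ^ 2 * κ ^ 2 * ((2 * ρ + 2 * s) * s) ^ 2 * Kμ ^ 2 := by
    field_simp
  rw [e2]
  have h2 : (2 * ρ + 2 * s) * s ≤ 40 * ρ * δ := by rw [hs]; nlinarith
  calc 36 * a ^ 2 * κ ^ 2 * ((2 * ρ + 2 * s) * s) ^ 2 * Kμ ^ 2
      ≤ 36 * a ^ 2 * κ ^ 2 * (40 * ρ * δ) ^ 2 * Kμ ^ 2 := by gcongr
    _ = 57600 * a ^ 2 * κ ^ 2 * ρ ^ 2 * (δ * δ) * Kμ ^ 2 := by ring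
    _ ≤ 57600 * a ^ 2 * κ ^ 2 * ρ ^ 2 * (ρ * η) * Kμ ^ 2 := by gcongr
    _ = 57600 * a ^ 2 * κ ^ 2 * ρ ^ 3 * η * Kμ ^ 2 := by ring

/-- **Stub S1 (`BandExpMoment`, the multi-scale machine with explicit scale cut-off; both lattices).**
For `E ∈ latticeEnsembles` and every order bound `A` there is `K₀ > 0` such that for every window
`B(x₀, ρ)`, every region `D ⊆ B(x₀, ρ)`, every loop functional `g` dominated by `κ · diam²` on the
loops inside `D` and VANISHING on the loops of diameter `≥ η` (`δ ≤ η ≤ ρ`), and every `a` with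
`|a| κ ρ² ≤ A`, the centred inner statistic `Σ_{u ⊆ D} g u` has `E e^{a(Σ − EΣ)} ≤ exp(K₀ a² κ² ρ³ η)`
at every mesh `0 < δ ≤ η` (integrability included). -/
theorem stub_bandExpMoment : ∀ E ∈ latticeEnsembles, ∀ A : ℝ, ∃ K₀ : ℝ, 0 < K₀ ∧
    ∀ (x₀ : ℂ) (ρ κ a δ η : ℝ) (D : Set ℂ) (g : UnbasedLoop ℂ → ℝ),
      0 < δ → δ ≤ η → η ≤ ρ → 0 ≤ κ → D ⊆ Metric.ball x₀ ρ →
      (∀ u : UnbasedLoop ℂ, u.range ⊆ D → |g u| ≤ κ * Metric.diam u.range ^ 2) →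
      (∀ u : UnbasedLoop ℂ, u.range ⊆ D → η ≤ Metric.diam u.range → g u = 0) →
      |a| * κ * ρ ^ 2 ≤ A →
      Integrable (fun ω ↦ Real.exp (a * ((∑ᶠ u ∈ {u ∈ (E.X δ ω).loops | u.range ⊆ D}, g u) -
        ∫ ω', (∑ᶠ u ∈ {u ∈ (E.X δ ω').loops | u.range ⊆ D}, g u) ∂E.P))) E.P ∧
      ∫ ω, Real.exp (a * ((∑ᶠ u ∈ {u ∈ (E.X δ ω).loops | u.range ⊆ D}, g u) -
        ∫ ω', (∑ᶠ u ∈ {u ∈ (E.X δ ω').loops | u.range ⊆ D}, g u) ∂E.P)) ∂E.P ≤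
        Real.exp (K₀ * a ^ 2 * κ ^ 2 * ρ ^ 3 * η) := by
  intro E hE A
  haveI := isProbabilityMeasure_of_mem hE
  -- the threshold `c₀ = 1` (kept opaque), the K6 constant at order `72 A + 1`, the microscopic count
  obtain ⟨c₀, hc₀⟩ : ∃ c₀ : ℝ, c₀ = 1 := ⟨1, rfl⟩
  have hc₀0 : 0 < c₀ := by rw [hc₀]; exact one_pos
  obtain ⟨K, -, hK⟩ :=
    expMoment_ncard_bigLoops_le_ball_free E hE (72 * A + 1) 6 1 one_pos (by norm_num)
  obtain ⟨M, hM⟩ := exists_ncard_loops_subset_ball_le E hE (12 * c₀)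
  set Kμ : ℝ := Real.exp ((288 * A + 1) * M) with hKμ
  refine ⟨4608 * K ^ 2 + 57600 * Kμ ^ 2 + 1, by positivity, ?_⟩
  intro x₀ ρ κ a δ η D g hδ hδη hηρ hκ hD hg hg0 haA
  obtain ⟨hη, hδρ⟩ : 0 < η ∧ δ ≤ ρ := ⟨hδ.trans_le hδη, hδη.trans hηρ⟩
  have hρ : 0 < ρ := hη.trans_le hηρ
  have hc₀δ : c₀ * δ = δ := by rw [hc₀, one_mul]
  -- the number `n` of K6 scales `h_k = η / 2^k`, `k < n` (`4δ < h_k`)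
  have hex : ∃ n : ℕ, η / 2 ^ n ≤ 4 * c₀ * δ := by
    obtain ⟨n, hn⟩ := exists_pow_lt_of_lt_one (show 0 < 4 * c₀ * δ / η by positivity)
      (show (1 / 2 : ℝ) < 1 by norm_num)
    refine ⟨n, ?_⟩
    calc η / 2 ^ n = η * (1 / 2) ^ n := by rw [one_div_pow, div_eq_mul_one_div]
      _ ≤ η * (4 * c₀ * δ / η) := mul_le_mul_of_nonneg_left hn.le hη.le
      _ = 4 * c₀ * δ := mul_div_cancel₀ _ hη.ne'
  classical
  obtain ⟨n, hn_spec, hn_min⟩ : ∃ n : ℕ, η / 2 ^ n ≤ 4 * c₀ * δ ∧ ∀ k < n, 4 * c₀ * δ < η / 2 ^ k :=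
    ⟨Nat.find hex, Nat.find_spec hex, fun k hk ↦ not_le.1 (Nat.find_min hex hk)⟩
  obtain ⟨sμ, hsμ⟩ : ∃ sμ : ℝ, sμ = 4 * c₀ * δ := ⟨_, rfl⟩
  have hs0 : 0 < sμ := by rw [hsμ]; positivity
  have hnμ : η / 2 ^ n ≤ sμ := hsμ ▸ hn_spec
  have hkη : ∀ k : ℕ, η / 2 ^ k ≤ η := fun k ↦ div_le_self hη.le (one_le_pow₀ (by norm_num))
  -- the cell families of the microscopic scale and of the K6 scales (inner-loop form), kept opaque
  obtain ⟨Yμ, hYμ⟩ : ∃ Yμ : ℤ × ℤ → E.Ω → ℝ, ∀ c ω, Yμ c ω = ∑ᶠ u ∈ {u ∈ (E.X δ ω).loops |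
      u.range ⊆ D ∩ BOX[sμ, c] ∧ (diam u.range < η / 2 ^ n ∧ IDX[sμ, u] = c)}, g u :=
    ⟨_, fun _ _ ↦ rfl⟩
  obtain ⟨Ys, hYs⟩ : ∃ Ys : ℕ → ℤ × ℤ → E.Ω → ℝ, ∀ k c ω, Ys k c ω = ∑ᶠ u ∈ {u ∈ (E.X δ ω).loops |
      u.range ⊆ D ∩ BOX[η / 2 ^ k, c] ∧
        ((η / 2 ^ k / 2 ≤ diam u.range ∧ diam u.range < η / 2 ^ k) ∧ IDX[η / 2 ^ k, u] = c)}, g u :=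
    ⟨_, fun _ _ _ ↦ rfl⟩
  -- pointwise decomposition of `S` (only the loops of diameter `< η` count)
  obtain ⟨N₀, hN₀⟩ := BigLoopsBall.exists_ncard_loops_sep_le_ball E hE hδ x₀ ρ
  have hdec : ∀ ω, (∑ᶠ u ∈ {u ∈ (E.X δ ω).loops | u.range ⊆ D}, g u) =
      ∑ c ∈ RNG[sμ, x₀, ρ], Yμ c ω + ∑ k ∈ Finset.range n, ∑ c ∈ RNG[η / 2 ^ k, x₀, ρ], Ys k c ω := by
    intro ω
    have hB : {u ∈ {u ∈ (E.X δ ω).loops | diam u.range < η} | u.range ⊆ D}.Finite :=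
      (hN₀ (fun u ↦ u.range ⊆ D) (fun u h ↦ h.trans hD) ω).1.subset fun u hu ↦ ⟨hu.1.1, hu.2⟩
    rw [bem_finsum_restrict _ D g hg0,
      UVFarBite.finsum_mem_eq_micro_add_sum_scales hB hη n (fun u hu ↦ hu.1.2) g]
    congr 1
    · rw [UVFarBite.finsum_mem_eq_sum_cells (hB.subset fun u hu ↦ hu.1) hs0
        (fun u hu ↦ hu.1.2.trans hD) g]
      refine Finset.sum_congr rfl fun c _ ↦ ?_
      rw [UVFarBite.sep_sep_idx_eq _ D hs0 _ (fun u hu ↦ (le_of_lt hu).trans hnμ) c,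
        bem_sep_micro_eq _ _ (hkη n) c, hYμ]
    · refine Finset.sum_congr rfl fun k _ ↦ ?_
      have hk' : 0 < η / 2 ^ k := by positivity
      rw [UVFarBite.finsum_mem_eq_sum_cells (hB.subset fun u hu ↦ hu.1) hk'
        (fun u hu ↦ hu.1.2.trans hD) g]
      refine Finset.sum_congr rfl fun c _ ↦ ?_
      rw [UVFarBite.sep_sep_idx_eq _ D hk' _ (fun u hu ↦ hu.2.le) c,
        bem_sep_scale_eq _ _ (hkη k) c, hYs]
  -- integrability and measurability of the families
  have hYμi : ∀ c, Integrable (Yμ c) E.P := fun c ↦ by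
    rw [show Yμ c = fun ω ↦ Yμ c ω from rfl]
    simp_rw [hYμ]
    exact UVFarBite.integrable_finsum_inner E hE hδ (D ∩ BOX[sμ, c]) CTR[sμ, c] (3 * sμ) _ g
      (b := κ * sμ ^ 2) (by positivity)
      (Set.inter_subset_right.trans (UVFarBite.cellBox_subset_ball hs0 c))
      fun u hu hq ↦ (hg u (hu.trans Set.inter_subset_left)).trans
        (mul_le_mul_of_nonneg_left (pow_le_pow_left₀ diam_nonneg (hq.1.le.trans hnμ) 2) hκ)
  have hYsi : ∀ k c, Integrable (Ys k c) E.P := fun k c ↦ by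
    rw [show Ys k c = fun ω ↦ Ys k c ω from rfl]
    simp_rw [hYs]
    exact UVFarBite.integrable_finsum_inner E hE hδ (D ∩ BOX[η / 2 ^ k, c]) CTR[η / 2 ^ k, c]
      (3 * (η / 2 ^ k)) _ g (b := κ * (η / 2 ^ k) ^ 2) (by positivity)
      (Set.inter_subset_right.trans (UVFarBite.cellBox_subset_ball (by positivity) c))
      fun u hu hq ↦ (hg u (hu.trans Set.inter_subset_left)).trans
        (mul_le_mul_of_nonneg_left (pow_le_pow_left₀ diam_nonneg hq.1.2.le 2) hκ)
  have hYμm : ∀ c, Measurable (Yμ c) := fun c ↦ by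
    rw [show Yμ c = fun ω ↦ Yμ c ω from rfl]
    simp_rw [hYμ]
    exact FirstMoment.measurable_finsum_loops_sep E hE δ _ g
  have hYsm : ∀ k c, Measurable (Ys k c) := fun k c ↦ by
    rw [show Ys k c = fun ω ↦ Ys k c ω from rfl]
    simp_rw [hYs]
    exact FirstMoment.measurable_finsum_loops_sep E hE δ _ g
  -- the mean of `S`
  have hES : ∫ ω', (∑ᶠ u ∈ {u ∈ (E.X δ ω').loops | u.range ⊆ D}, g u) ∂E.P =
      ∑ c ∈ RNG[sμ, x₀, ρ], ∫ ω', Yμ c ω' ∂E.P +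
        ∑ k ∈ Finset.range n, ∑ c ∈ RNG[η / 2 ^ k, x₀, ρ], ∫ ω', Ys k c ω' ∂E.P := by
    rw [integral_congr_ae (ae_of_all _ hdec)]
    rw [integral_add (integrable_finsetSum _ fun c _ ↦ hYμi c)
      (integrable_finsetSum _ fun k _ ↦ integrable_finsetSum _ fun c _ ↦ hYsi k c),
      integral_finsetSum _ fun c _ ↦ hYμi c,
      integral_finsetSum _ fun k _ ↦ integrable_finsetSum _ fun c _ ↦ hYsi k c]
    congr 1
    exact Finset.sum_congr rfl fun k _ ↦ integral_finsetSum _ fun c _ ↦ hYsi k c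
  -- the pieces `Z`, weights `w` and exponents `B`, kept opaque
  obtain ⟨w, hw0, hwS⟩ : ∃ w : ℕ → ℝ, w 0 = 1 / 2 ∧ ∀ k, w (k + 1) = 1 / (8 * 2 ^ k) :=
    ⟨fun p ↦ Nat.rec (1 / 2) (fun k _ ↦ 1 / (8 * 2 ^ k)) p, rfl, fun _ ↦ rfl⟩
  obtain ⟨Z, hZ0, hZS⟩ : ∃ Z : ℕ → E.Ω → ℝ,
      (∀ ω, Z 0 ω = a * ∑ c ∈ RNG[sμ, x₀, ρ], (Yμ c ω - ∫ ω', Yμ c ω' ∂E.P)) ∧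
      ∀ k ω, Z (k + 1) ω = a * ∑ c ∈ RNG[η / 2 ^ k, x₀, ρ], (Ys k c ω - ∫ ω', Ys k c ω' ∂E.P) :=
    ⟨fun p ω ↦ Nat.rec (a * ∑ c ∈ RNG[sμ, x₀, ρ], (Yμ c ω - ∫ ω', Yμ c ω' ∂E.P))
      (fun k _ ↦ a * ∑ c ∈ RNG[η / 2 ^ k, x₀, ρ], (Ys k c ω - ∫ ω', Ys k c ω' ∂E.P)) p,
      fun _ ↦ rfl, fun _ _ ↦ rfl⟩
  obtain ⟨Kμ', hKμ'⟩ : ∃ Kμ' : ℝ, Kμ' = Real.exp ((9 * (|a / (1 / 2)| * (κ * sμ ^ 2)) + 1) * M) :=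
    ⟨_, rfl⟩
  obtain ⟨B, hB0, hBS⟩ : ∃ B : ℕ → ℝ,
      B 0 = 1 / 2 * (2 * (RNG[sμ, x₀, ρ]).card * (9 : ℕ) * (a / (1 / 2)) ^ 2 * (κ * sμ ^ 2) ^ 2 *
        Kμ' ^ 2) ∧
      ∀ k, B (k + 1) = 1 / (8 * 2 ^ k) * (2 * (RNG[η / 2 ^ k, x₀, ρ]).card * (9 : ℕ) *
        (a / (1 / (8 * 2 ^ k))) ^ 2 * (κ * (η / 2 ^ k) ^ 2) ^ 2 * K ^ 2) :=
    ⟨fun p ↦ Nat.rec (1 / 2 * (2 * (RNG[sμ, x₀, ρ]).card * (9 : ℕ) * (a / (1 / 2)) ^ 2 *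
        (κ * sμ ^ 2) ^ 2 * Kμ' ^ 2))
      (fun k _ ↦ 1 / (8 * 2 ^ k) * (2 * (RNG[η / 2 ^ k, x₀, ρ]).card * (9 : ℕ) *
        (a / (1 / (8 * 2 ^ k))) ^ 2 * (κ * (η / 2 ^ k) ^ 2) ^ 2 * K ^ 2)) p, rfl, fun _ ↦ rfl⟩
  -- the microscopic piece
  have hp0 : Integrable (fun ω ↦ Real.exp (Z 0 ω / w 0)) E.P ∧
      ∫ ω, Real.exp (Z 0 ω / w 0) ∂E.P ≤ Real.exp (B 0 / w 0) := by
    have key := UVFarBite.microPiece E hE c₀ M hc₀.ge hM x₀ ρ κ (a / (1 / 2)) δ (η / 2 ^ n) D g hκ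
      hδ hg hn_spec
    have e1 : (fun ω ↦ Real.exp (Z 0 ω / w 0)) = fun ω ↦ Real.exp (a / (1 / 2) *
        ∑ c ∈ RNG[sμ, x₀, ρ], (Yμ c ω - ∫ ω', Yμ c ω' ∂E.P)) := funext fun ω ↦ by
      rw [hZ0, hw0, mul_div_right_comm]
    have e2 : B 0 / w 0 = 2 * (RNG[sμ, x₀, ρ]).card * (9 : ℕ) * (a / (1 / 2)) ^ 2 *
        (κ * sμ ^ 2) ^ 2 * Kμ' ^ 2 := by
      rw [hB0, hw0, mul_div_cancel_left₀ _ (by norm_num : (1 / 2 : ℝ) ≠ 0)]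
    rw [e1, e2, hKμ']
    simpa only [hYμ, hsμ] using key
  -- the K6 pieces
  have hpS : ∀ k < n, Integrable (fun ω ↦ Real.exp (Z (k + 1) ω / w (k + 1))) E.P ∧
      ∫ ω, Real.exp (Z (k + 1) ω / w (k + 1)) ∂E.P ≤ Real.exp (B (k + 1) / w (k + 1)) := by
    intro k hk
    have hside : 4 * c₀ * δ < η / 2 ^ k := hn_min k hk
    have hch : c₀ * δ ≤ η / 2 ^ k / 2 := by linarith [hc₀δ]
    have h2δ : 2 * δ < η / 2 ^ k := by linarith [hc₀δ]
    have hwpos : 0 < 1 / (8 * (2 : ℝ) ^ k) := by positivity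
    have hl : 9 * (|a / (1 / (8 * 2 ^ k))| * (κ * (η / 2 ^ k) ^ 2)) ≤ 72 * A := by
      refine (bem_order_scale_le a κ η hκ k).trans ?_
      have : |a| * κ * η ^ 2 ≤ |a| * κ * ρ ^ 2 := by gcongr
      linarith
    have key := UVFarBite.scalePiece E hE (72 * A) K c₀ (fun x l δ' hl hδ' _ ↦ hK x l δ' hl hδ') x₀ ρ
      κ a δ (η / 2 ^ k) (1 / (8 * 2 ^ k)) D g hκ hδ hg hwpos hch h2δ hl
    have e1 : (fun ω ↦ Real.exp (Z (k + 1) ω / w (k + 1))) = fun ω ↦ Real.exp (a / (1 / (8 * 2 ^ k)) *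
        ∑ c ∈ RNG[η / 2 ^ k, x₀, ρ], (Ys k c ω - ∫ ω', Ys k c ω' ∂E.P)) := funext fun ω ↦ by
      rw [hZS, hwS, mul_div_right_comm]
    have e2 : B (k + 1) / w (k + 1) = 2 * (RNG[η / 2 ^ k, x₀, ρ]).card * (9 : ℕ) *
        (a / (1 / (8 * 2 ^ k))) ^ 2 * (κ * (η / 2 ^ k) ^ 2) ^ 2 * K ^ 2 := by
      rw [hBS, hwS, mul_div_cancel_left₀ _ hwpos.ne']
    rw [e1, e2]
    simpa only [hYs] using key
  have hpiece : ∀ p ∈ Finset.range (n + 1), Integrable (fun ω ↦ Real.exp (Z p ω / w p)) E.P ∧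
      ∫ ω, Real.exp (Z p ω / w p) ∂E.P ≤ Real.exp (B p / w p) := by
    intro p hp
    cases p with
    | zero => exact hp0
    | succ k => exact hpS k (by simpa using hp)
  -- assembly across the pieces
  have hZm : ∀ p ∈ Finset.range (n + 1), Measurable (Z p) := by
    intro p _
    cases p with
    | zero =>
      rw [show Z 0 = fun ω ↦ Z 0 ω from rfl]
      simp_rw [hZ0]
      exact (Finset.measurable_sum _ fun c _ ↦ (hYμm c).sub_const _).const_mul _
    | succ k =>
      rw [show Z (k + 1) = fun ω ↦ Z (k + 1) ω from rfl]
      simp_rw [hZS]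
      exact (Finset.measurable_sum _ fun c _ ↦ (hYsm k c).sub_const _).const_mul _
  have hwpos : ∀ p ∈ Finset.range (n + 1), 0 < w p := by
    intro p _
    cases p with
    | zero => rw [hw0]; norm_num
    | succ k => rw [hwS]; positivity
  have hwsum : ∑ p ∈ Finset.range (n + 1), w p ≤ 1 := by
    rw [Finset.sum_range_succ', hw0]
    simp_rw [hwS, UVFarBite.weight_eq, ← Finset.mul_sum]
    have := BigLoopsExp.geom_sum_range_le_two (by norm_num : (0 : ℝ) ≤ 1 / 2)
      (by norm_num : (1 / 2 : ℝ) ≤ 1 / 2) n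
    linarith
  obtain ⟨hI, hle⟩ := expMoment_scaleSum_le_latticeEnsembles E hE (n + 1) Z w B hZm hwpos hwsum hpiece
  -- identification of the integrand
  have hZsum : ∀ ω, ∑ p ∈ Finset.range (n + 1), Z p ω =
      a * ((∑ᶠ u ∈ {u ∈ (E.X δ ω).loops | u.range ⊆ D}, g u) -
        ∫ ω', (∑ᶠ u ∈ {u ∈ (E.X δ ω').loops | u.range ⊆ D}, g u) ∂E.P) := by
    intro ω
    rw [Finset.sum_range_succ', hZ0, hdec ω, hES]
    simp_rw [hZS]
    rw [← Finset.mul_sum, Finset.sum_sub_distrib]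
    simp_rw [Finset.sum_sub_distrib]
    ring
  have hfun : (fun ω ↦ Real.exp (a * ((∑ᶠ u ∈ {u ∈ (E.X δ ω).loops | u.range ⊆ D}, g u) -
      ∫ ω', (∑ᶠ u ∈ {u ∈ (E.X δ ω').loops | u.range ⊆ D}, g u) ∂E.P))) =
      fun ω ↦ Real.exp (∑ p ∈ Finset.range (n + 1), Z p ω) := funext fun ω ↦ by rw [hZsum]
  rw [hfun]
  refine ⟨hI, hle.trans (Real.exp_le_exp.2 ?_)⟩
  -- the exponents
  rw [Finset.sum_range_succ', hB0]
  simp_rw [hBS]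
  have hKμ'K : Kμ' ≤ Kμ := by
    rw [hKμ', hKμ]
    refine Real.exp_le_exp.2 (mul_le_mul_of_nonneg_right ?_ (Nat.cast_nonneg M))
    rw [abs_div, abs_of_pos (by norm_num : (0 : ℝ) < 1 / 2)]
    have h1 : 9 * (|a| / (1 / 2) * (κ * sμ ^ 2)) = 288 * (|a| * κ * δ ^ 2) := by
      rw [hsμ, hc₀]; ring
    have h2 : |a| * κ * δ ^ 2 ≤ |a| * κ * ρ ^ 2 := by gcongr
    linarith
  have hmicro := bem_exponent_micro_le (a := a) (κ := κ) hδ hδη hηρ hsμ hc₀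
    (UVFarBite.card_cellRange_le hs0 x₀ hρ.le) (by rw [hKμ']; exact (Real.exp_pos _).le) hKμ'K
  have hscales : ∑ k ∈ Finset.range n, 1 / (8 * 2 ^ k) * (2 * (RNG[η / 2 ^ k, x₀, ρ]).card * (9 : ℕ) *
      (a / (1 / (8 * 2 ^ k))) ^ 2 * (κ * (η / 2 ^ k) ^ 2) ^ 2 * K ^ 2) ≤
      4608 * K ^ 2 * (a ^ 2 * κ ^ 2 * ρ ^ 3 * η) := by
    calc _ ≤ ∑ k ∈ Finset.range n, 2304 * a ^ 2 * κ ^ 2 * ρ ^ 2 * η ^ 2 * K ^ 2 * (1 / 2) ^ k :=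
          Finset.sum_le_sum fun k _ ↦ bem_exponent_scale_le hη hηρ k
            (UVFarBite.card_cellRange_le (by positivity) x₀ hρ.le)
      _ = 2304 * a ^ 2 * κ ^ 2 * ρ ^ 2 * η ^ 2 * K ^ 2 * ∑ k ∈ Finset.range n, (1 / 2 : ℝ) ^ k := by
          rw [Finset.mul_sum]
      _ ≤ 2304 * a ^ 2 * κ ^ 2 * ρ ^ 2 * η ^ 2 * K ^ 2 * 2 :=
          mul_le_mul_of_nonneg_left (BigLoopsExp.geom_sum_range_le_two (by norm_num) (by norm_num) n)
            (by positivity)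
      _ = 4608 * K ^ 2 * (a ^ 2 * κ ^ 2 * ρ ^ 2 * (η * η)) := by ring
      _ ≤ 4608 * K ^ 2 * (a ^ 2 * κ ^ 2 * ρ ^ 2 * (ρ * η)) := by gcongr
      _ = 4608 * K ^ 2 * (a ^ 2 * κ ^ 2 * ρ ^ 3 * η) := by ring
  have hpos : 0 ≤ a ^ 2 * κ ^ 2 * ρ ^ 3 * η := by positivity
  nlinarith [hmicro, hscales, hpos]

end Summit.CriticalPhenomena.CardyFormulaZ2.Cruxes.MagicFormulaT.LineSketch

end
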